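import Literature.MathematicalPhysics.QuantumFieldTheory.ConformalBootstrap3D.DimensionalReductionClosure
import Literature.MathematicalPhysics.QuantumFieldTheory.ConformalBootstrap3D.FreeScalarBlockDecomposition
import Mathlib.Tactic
import HarnessLib

/-!
# Hogervorst's reduction formula at the unitarity bound `Δ = ℓ + 1` (`d = 3`, `ℓ ≥ 1`): the zero-twist limit

At the unitarity bound of a spinning operator (`Δ = ℓ + 1`, twist `τ = Δ - ℓ - (d-2) = 0` at `d = 3`)
Hogervorst's closed form for the `3 → 2` reduction coefficients degenerates (`0·∞`), but its LIMIT is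
printed: "In the zero-twist limit, the coefficients `𝒜_{n,j}` simplify:
`𝒜_{n,j}(Δ,ℓ) →_{τ→0} Z_ℓ^j c_ℓ^{(d)}/c_j^{(d-1)} × ε_n(ℓ)` for `j = ℓ`, `δ_{n,0}(…)` for `j < ℓ`", with
`ε_n(ℓ) = (½)_n/(16^n n!) · (ℓ+2ν-1)_{2n}(ℓ+ν)_n/((ℓ+ν-½)_{2n}(ℓ+ν+½)_n)`
[cite: Hogervorst2016, App. A (zero-twist limit of `𝒜_{n,j}`; used there for the free-field consistency
check)]. At `ν = ½`: `ε_n(ℓ) = (½)_n (ℓ+½)_n / (16^n n! (ℓ+1)_n)`.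

In the lattice variables of `DimensionalReductionSpin` (`a = n + (ℓ+j)/2`, `b = n + (ℓ-j)/2`) this says: the
site function of the conserved-current block `g_{ℓ+1,ℓ}` is supported on LEVEL `0` (`c_{x,ℓ-x} =
λ_xλ_{ℓ-x}/λ_ℓ`, the Legendre boundary layer) and on the two EDGES `|a-b| = ℓ` (`c_{n,n+ℓ} = c_{n+ℓ,n} =
ε_n(ℓ)`) — `boundSite ℓ`. This file proves

* `hrMonomialCoeff_eq_bound_redArr (hℓ : 1 ≤ ℓ) : hrMonomialCoeff (ℓ+1) ℓ = redArr (ℓ+1) ℓ (boundSite ℓ)` —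
  by letting `Δ ↓ ℓ+1` in `hrMonomialCoeff_eq_spin_redArr_of_lt` (`DimensionalReductionClosure`): the
  left side is continuous at the admissible bound point (`IsAdmissible3D.continuousAt_hrMonomialCoeff`,
  `BlockExistenceLimit`), and each `c_{ab}(Δ) → boundSite ℓ a b` (§2: interior sites `→ 0` since
  `E_n ∝ (α-½)_n`, edge sites after cancelling `(α)_n/(α-½)_n` against `E_n`);
* `boundSite_nonneg`, hence **`hrBlock_hasSum_bound`**: on the open square
  `g_{ℓ+1,ℓ}(x,y) = Σ_{a,b} boundSite ℓ a b · k_{1+2a}(x) k_{1+2b}(y)` — the conserved-current blocks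
  (stress tensor: `ℓ = 2`, `Δ = 3`) as explicit non-negative combinations of products of SL(2) blocks
  (via `hasSum_redArr_sl2Block_of_hasSum`, the generic form of `DimensionalReductionSeries.hasSum_redArr_sl2Block`
  fed with the bound `z`-series `hasSum_hrSeries_bound` of `FreeScalarBlockDecomposition`).

* §5–§6: with the generic cores of `EvenSectorRadialPositivity` (`HasSL2Reduction`, `HasZData`), the radial
  monomial array is `≥ 0` and the radial monomial expansion converges on the WHOLE square at the bound
  (`zRhoConv_nonneg_bound`, `hasSum_zRhoConv_hrBlock_bound`) and hence at EVERY admissible spinning point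
  `Δ ≥ ℓ + 1` (`zRhoConv_nonneg_of_bound_le`, `hasSum_zRhoConv_hrBlock_of_bound_le`,
  `IsConformalBlock3D.hasSum_zRhoConv_even_of_bound_le`); §7 packages `ℓ = 0` (every `Δ > ½`,
  `EvenSectorRadialPositivity`) and `ℓ ≥ 1` into ONE statement for every `IsAdmissible3D Δ ℓ`
  (`zRhoConv_nonneg_of_isAdmissible`, `IsConformalBlock3D.hasSum_zRhoConv_of_isAdmissible`).

pub-ising3d RECIPE R19(i) (AXIOMS-SOURCES S20.7). Second implementation: the predicted site function agrees
with a triangular 2D-block solve of the tree's `z`-series at `Δ = ℓ+1` for `ℓ = 1…5`, `a+b ≤ 10`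
(330 sites, exact rationals; pub-ising3d-lit-g13/code/bound_limit_check.py). No named fact.
-/

namespace Literature.MathematicalPhysics.QuantumFieldTheory.ConformalBootstrap3D

open Finset Set Filter
open scoped Topology

/-! ### §1. The site function at the bound -/

/-- `ε_n(ℓ) = (½)_n (ℓ+½)_n / (16^n n! (ℓ+1)_n)` (Hogervorst's `ε_n(ℓ)` at `ν = ½`).
[cite: Hogervorst2016, App. A] -/
noncomputable def boundEps (ℓ n : ℕ) : ℝ :=
  poch (1 / 2) n * poch ((ℓ : ℝ) + 1 / 2) n / ((16 : ℝ) ^ n * (n.factorial : ℝ) * poch ((ℓ : ℝ) + 1) n)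

/-- **The site function of the conserved-current block** `g_{ℓ+1,ℓ}`: level `0` carries the Legendre layer
`λ_aλ_b/λ_ℓ` (`a + b = ℓ`), the two edges `b = a + ℓ`, `a = b + ℓ` carry `ε_{min(a,b)}(ℓ)`, everything
else vanishes. [cite: Hogervorst2016, App. A] -/
noncomputable def boundSite (ℓ : ℕ) (a b : ℕ) : ℝ :=
  if a + b = ℓ then legendreLam a * legendreLam b / legendreLam ℓ
  else if b = a + ℓ then boundEps ℓ a
  else if a = b + ℓ then boundEps ℓ b
  else 0

/-- `ε_n(ℓ) > 0`. [folklore] -/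
theorem boundEps_pos (ℓ n : ℕ) : 0 < boundEps ℓ n := by
  unfold boundEps
  have h1 := poch_pos (by norm_num : (0 : ℝ) < 1 / 2) n
  have h2 := poch_pos (by positivity : (0 : ℝ) < (ℓ : ℝ) + 1 / 2) n
  have h3 := poch_pos (by positivity : (0 : ℝ) < (ℓ : ℝ) + 1) n
  positivity

/-- `ε_0(ℓ) = 1`. [folklore] -/
@[simp] theorem boundEps_zero (ℓ : ℕ) : boundEps ℓ 0 = 1 := by
  simp [boundEps]

/-- **The bound site function is non-negative.** [cite: Hogervorst2016, App. A] -/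
theorem boundSite_nonneg (ℓ : ℕ) : ∀ a b : ℕ, 0 ≤ boundSite ℓ a b := fun a b => by
  unfold boundSite
  split_ifs
  · exact div_nonneg (mul_nonneg (legendreLam_pos a).le (legendreLam_pos b).le) (legendreLam_pos ℓ).le
  · exact (boundEps_pos ℓ a).le
  · exact (boundEps_pos ℓ b).le
  · exact le_rfl

/-- Symmetry of the bound site function. [folklore] -/
theorem boundSite_symm (ℓ a b : ℕ) : boundSite ℓ a b = boundSite ℓ b a := by
  unfold boundSite
  by_cases h0 : a + b = ℓ
  · rw [if_pos h0, if_pos (by omega : b + a = ℓ)]; ring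
  rw [if_neg h0, if_neg (by omega : ¬ b + a = ℓ)]
  by_cases h1 : b = a + ℓ
  · by_cases h2 : a = b + ℓ
    · rw [if_pos h1, if_pos h2]
      have hab : a = b := by omega
      rw [hab]
    · rw [if_pos h1, if_neg h2, if_pos h1]
  · by_cases h2 : a = b + ℓ
    · rw [if_neg h1, if_pos h2, if_pos h2]
    · rw [if_neg h1, if_neg h2, if_neg h2, if_neg h1]

/-! ### §2. The limit `Δ ↓ ℓ + 1` of Hogervorst's site function -/

/-- `Δ ↦ G_n(x)` is continuous wherever `α₀ + x - ½ > 0` (in particular at the bound for `x ≥ 1`,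
and for `x = ℓ ≥ 1`). [folklore] -/
theorem continuousAt_spinG_of_pos {Δ₀ : ℝ} {ℓ : ℕ} {x : ℕ} (h : 0 < halfTwist Δ₀ ℓ + (x : ℝ) - 1 / 2)
    (n : ℕ) : ContinuousAt (fun Δ : ℝ => spinG Δ ℓ n x) Δ₀ := by
  unfold spinG
  have h1 : Continuous fun Δ : ℝ => poch (halfTwist Δ ℓ + (x : ℝ)) n :=
    (continuous_poch n).comp ((continuous_halfTwist ℓ).add continuous_const)
  have h2 : Continuous fun Δ : ℝ => poch (halfTwist Δ ℓ + (x : ℝ) - 1 / 2) n :=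
    (continuous_poch n).comp (((continuous_halfTwist ℓ).add continuous_const).sub continuous_const)
  exact continuousAt_const.mul (h1.continuousAt.div h2.continuousAt (poch_ne_zero h n))

/-- `Δ ↦ E_n` is continuous wherever `Δ₀ > ½` and `α₀ > 0` (in particular at the bound `α₀ = ½`).
[folklore] -/
theorem continuousAt_spinE_of_pos {Δ₀ : ℝ} {ℓ : ℕ} (hΔ : 1 / 2 < Δ₀) (hα : 0 < halfTwist Δ₀ ℓ) (n : ℕ) :
    ContinuousAt (fun Δ : ℝ => spinE Δ ℓ n) Δ₀ := by
  unfold spinE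
  have hl0 : (0 : ℝ) ≤ ℓ := Nat.cast_nonneg ℓ
  have hnum : Continuous fun Δ : ℝ => poch (1 / 2) n * poch (Δ - 1) n * poch (halfTwist Δ ℓ + ℓ) n *
      poch (halfTwist Δ ℓ - 1 / 2) n :=
    ((continuous_const.mul ((continuous_poch n).comp (continuous_id.sub continuous_const))).mul
      ((continuous_poch n).comp ((continuous_halfTwist ℓ).add continuous_const))).mul
      ((continuous_poch n).comp ((continuous_halfTwist ℓ).sub continuous_const))
  have hden : Continuous fun Δ : ℝ => (16 : ℝ) ^ n * (n.factorial : ℝ) * poch (Δ - 1 / 2) n *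
      poch (halfTwist Δ ℓ + ℓ + 1 / 2) n * poch (halfTwist Δ ℓ) n :=
    (((continuous_const.mul ((continuous_poch n).comp (continuous_id.sub continuous_const))).mul
      ((continuous_poch n).comp (((continuous_halfTwist ℓ).add continuous_const).add continuous_const))).mul
      ((continuous_poch n).comp (continuous_halfTwist ℓ)))
  refine hnum.continuousAt.div hden.continuousAt ?_
  have h1 := poch_pos (by linarith : (0 : ℝ) < Δ₀ - 1 / 2) n
  have h2 := poch_pos (by linarith : (0 : ℝ) < halfTwist Δ₀ ℓ + ℓ + 1 / 2) n
  have h3 := poch_pos hα n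
  positivity

/-- `α = ½` at the bound. [folklore] -/
theorem halfTwist_bound (ℓ : ℕ) : halfTwist ((ℓ : ℝ) + 1) ℓ = 1 / 2 := by
  unfold halfTwist; ring

/-- `E_n(ℓ+1) = 0` for `n ≥ 1` (the factor `(α-½)_n = (0)_n`). [cite: Hogervorst2016, App. A] -/
theorem spinE_bound_succ (ℓ n : ℕ) : spinE ((ℓ : ℝ) + 1) ℓ (n + 1) = 0 := by
  unfold spinE
  rw [halfTwist_bound, show (1 : ℝ) / 2 - 1 / 2 = 0 by ring]
  have h0 : poch (0 : ℝ) (n + 1) = 0 := by rw [poch_succ_left]; simp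
  rw [h0, mul_zero, zero_div]

/-- The edge value with the singular factors cancelled:
`R_n(Δ) = (½)_n (Δ-1)_n (α+ℓ)_n / (16^n n! (Δ-½)_n (α+ℓ+½)_n) · G_n(ℓ)/λ_ℓ`. [folklore] -/
noncomputable def edgeR (Δ : ℝ) (ℓ n : ℕ) : ℝ :=
  poch (1 / 2) n * poch (Δ - 1) n * poch (halfTwist Δ ℓ + ℓ) n /
      ((16 : ℝ) ^ n * (n.factorial : ℝ) * poch (Δ - 1 / 2) n * poch (halfTwist Δ ℓ + ℓ + 1 / 2) n) *
    spinG Δ ℓ n ℓ / legendreLam ℓ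

/-- `G_n(0)·E_n` with the singular factors `(α)_n/(α-½)_n` cancelled (strictly above the bound).
[cite: Hogervorst2016, §2 eqs. (2.24), (2.35)] -/
theorem spinG_zero_mul_spinE {Δ : ℝ} {ℓ : ℕ} (hΔ : (ℓ : ℝ) + 1 < Δ) (n : ℕ) :
    spinG Δ ℓ n 0 * spinE Δ ℓ n =
      poch (1 / 2) n * poch (Δ - 1) n * poch (halfTwist Δ ℓ + ℓ) n /
        ((16 : ℝ) ^ n * (n.factorial : ℝ) * poch (Δ - 1 / 2) n * poch (halfTwist Δ ℓ + ℓ + 1 / 2) n) := by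
  have hα : 1 / 2 < halfTwist Δ ℓ := by unfold halfTwist; linarith
  unfold spinG spinE
  simp only [Nat.cast_zero, add_zero, legendreLam_zero, one_mul]
  have hl0 : (0 : ℝ) ≤ ℓ := Nat.cast_nonneg ℓ
  set A := poch (halfTwist Δ ℓ - 1 / 2) n with hA
  set B := poch (halfTwist Δ ℓ) n with hB
  set C := poch (Δ - 1 / 2) n with hC
  set D := poch (halfTwist Δ ℓ + ℓ + 1 / 2) n with hD
  have h1 : A ≠ 0 := poch_ne_zero (by linarith) n
  have h2 : B ≠ 0 := poch_ne_zero (by linarith) n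
  have h3 : C ≠ 0 := poch_ne_zero (by linarith) n
  have h4 : D ≠ 0 := poch_ne_zero (by linarith) n
  have h6 : ((16 : ℝ) ^ n * (n.factorial : ℝ)) ≠ 0 := by positivity
  rw [div_mul_div_comm, div_eq_div_iff (mul_ne_zero h1 (by positivity)) (by positivity)]
  ring

/-- On the edge `(a,b) = (n, n+ℓ)` and strictly above the bound, Hogervorst's site function equals `R_n(Δ)`.
[cite: Hogervorst2016, §2 eqs. (2.24), (2.35)] -/
theorem spinSite_edge_eq {Δ : ℝ} {ℓ : ℕ} (hΔ : (ℓ : ℝ) + 1 < Δ) (n : ℕ) :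
    spinSite Δ ℓ n (n + ℓ) = edgeR Δ ℓ n := by
  have hv := spinSite_val (Δ := Δ) (ℓ := ℓ) n 0 ℓ (by omega)
  rw [Nat.add_zero] at hv
  rw [hv, show spinG Δ ℓ n 0 * spinG Δ ℓ n ℓ * spinE Δ ℓ n = (spinG Δ ℓ n 0 * spinE Δ ℓ n) * spinG Δ ℓ n ℓ
    by ring, spinG_zero_mul_spinE hΔ n]
  rfl

/-- `R_n` is continuous at the bound (`ℓ ≥ 1`: the denominator `(α+ℓ-½)_n = (ℓ)_n` of `G_n(ℓ)` is
positive there). [folklore] -/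
theorem continuousAt_edgeR {ℓ : ℕ} (hℓ : 1 ≤ ℓ) (n : ℕ) :
    ContinuousAt (fun Δ : ℝ => edgeR Δ ℓ n) ((ℓ : ℝ) + 1) := by
  unfold edgeR
  have hl1 : (1 : ℝ) ≤ ℓ := by exact_mod_cast hℓ
  have hαb := halfTwist_bound ℓ
  have hnum : Continuous fun Δ : ℝ => poch (1 / 2) n * poch (Δ - 1) n * poch (halfTwist Δ ℓ + ℓ) n :=
    (continuous_const.mul ((continuous_poch n).comp (continuous_id.sub continuous_const))).mul
      ((continuous_poch n).comp ((continuous_halfTwist ℓ).add continuous_const))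
  have hden : Continuous fun Δ : ℝ => (16 : ℝ) ^ n * (n.factorial : ℝ) * poch (Δ - 1 / 2) n *
      poch (halfTwist Δ ℓ + ℓ + 1 / 2) n :=
    (continuous_const.mul ((continuous_poch n).comp (continuous_id.sub continuous_const))).mul
      ((continuous_poch n).comp (((continuous_halfTwist ℓ).add continuous_const).add continuous_const))
  have hden0 : (16 : ℝ) ^ n * (n.factorial : ℝ) * poch ((ℓ : ℝ) + 1 - 1 / 2) n *
      poch (halfTwist ((ℓ : ℝ) + 1) ℓ + ℓ + 1 / 2) n ≠ 0 := by
    rw [hαb]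
    have h1 := poch_pos (by linarith : (0 : ℝ) < (ℓ : ℝ) + 1 - 1 / 2) n
    have h2 := poch_pos (by linarith : (0 : ℝ) < 1 / 2 + ℓ + 1 / 2) n
    positivity
  have hG : ContinuousAt (fun Δ : ℝ => spinG Δ ℓ n ℓ) ((ℓ : ℝ) + 1) :=
    continuousAt_spinG_of_pos (by rw [hαb]; linarith) n
  exact ((hnum.continuousAt.div hden.continuousAt hden0).mul hG).div_const _

/-- `R_n(ℓ+1) = ε_n(ℓ)` (`ℓ ≥ 1`). [cite: Hogervorst2016, App. A] -/
theorem edgeR_bound {ℓ : ℕ} (hℓ : 1 ≤ ℓ) (n : ℕ) : edgeR ((ℓ : ℝ) + 1) ℓ n = boundEps ℓ n := by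
  unfold edgeR boundEps spinG
  rw [halfTwist_bound]
  have hl1 : (1 : ℝ) ≤ ℓ := by exact_mod_cast hℓ
  have e1 : (ℓ : ℝ) + 1 - 1 = ℓ := by ring
  have e2 : (ℓ : ℝ) + 1 - 1 / 2 = ℓ + 1 / 2 := by ring
  have e3 : (1 : ℝ) / 2 + ℓ + 1 / 2 = ℓ + 1 := by ring
  have e4 : (1 : ℝ) / 2 + ℓ = ℓ + 1 / 2 := by ring
  have e5 : (1 : ℝ) / 2 + ℓ - 1 / 2 = ℓ := by ring
  rw [e1, e2, e3, e5, e4]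
  set A := poch (ℓ : ℝ) n with hA
  set B := poch ((ℓ : ℝ) + 1 / 2) n with hB
  set C := poch ((ℓ : ℝ) + 1) n with hC
  set P := poch (1 / 2 : ℝ) n with hP
  have h1 : A ≠ 0 := poch_ne_zero (by linarith) n
  have h2 : B ≠ 0 := poch_ne_zero (by linarith) n
  have h3 : C ≠ 0 := poch_ne_zero (by linarith) n
  have h5 : legendreLam ℓ ≠ 0 := (legendreLam_pos ℓ).ne'
  have h6 : ((16 : ℝ) ^ n * (n.factorial : ℝ)) ≠ 0 := by positivity
  rw [div_eq_div_iff (by positivity) (by positivity)]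
  field_simp

/-- Edge limit: `c_{n,n+ℓ}(Δ) → ε_n(ℓ)` as `Δ ↓ ℓ+1` (`ℓ ≥ 1`). [cite: Hogervorst2016, App. A] -/
theorem tendsto_spinSite_edge {ℓ : ℕ} (hℓ : 1 ≤ ℓ) (n : ℕ) :
    Tendsto (fun Δ : ℝ => spinSite Δ ℓ n (n + ℓ)) (𝓝[>] ((ℓ : ℝ) + 1)) (𝓝 (boundEps ℓ n)) := by
  have hev : (fun Δ : ℝ => edgeR Δ ℓ n) =ᶠ[𝓝[>] ((ℓ : ℝ) + 1)] fun Δ => spinSite Δ ℓ n (n + ℓ) := by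
    filter_upwards [self_mem_nhdsWithin] with Δ hΔ
    exact (spinSite_edge_eq (mem_Ioi.mp hΔ) n).symm
  have h : Tendsto (fun Δ : ℝ => edgeR Δ ℓ n) (𝓝[>] ((ℓ : ℝ) + 1)) (𝓝 (edgeR ((ℓ : ℝ) + 1) ℓ n)) :=
    (continuousAt_edgeR hℓ n).mono_left nhdsWithin_le_nhds
  rw [edgeR_bound hℓ] at h
  exact h.congr' hev

/-- Interior limit: for `n ≥ 1` and `x, y ≥ 1` with `x + y = ℓ`, `c_{n+x,n+y}(Δ) → 0` as `Δ → ℓ+1`.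
[cite: Hogervorst2016, App. A] -/
theorem tendsto_spinSite_interior {ℓ : ℕ} {n x y : ℕ} (hn : 1 ≤ n) (hx : 1 ≤ x) (hy : 1 ≤ y)
    (hxy : x + y = ℓ) :
    Tendsto (fun Δ : ℝ => spinSite Δ ℓ (n + x) (n + y)) (𝓝[>] ((ℓ : ℝ) + 1)) (𝓝 0) := by
  have hfun : (fun Δ : ℝ => spinSite Δ ℓ (n + x) (n + y)) =
      fun Δ => spinG Δ ℓ n x * spinG Δ ℓ n y * spinE Δ ℓ n / legendreLam ℓ :=
    funext fun Δ => spinSite_val (Δ := Δ) (ℓ := ℓ) n x y hxy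
  rw [hfun]
  have hαb := halfTwist_bound ℓ
  have hx1 : (1 : ℝ) ≤ x := by exact_mod_cast hx
  have hy1 : (1 : ℝ) ≤ y := by exact_mod_cast hy
  have hl0 : (0 : ℝ) ≤ ℓ := Nat.cast_nonneg ℓ
  have hGx : ContinuousAt (fun Δ : ℝ => spinG Δ ℓ n x) ((ℓ : ℝ) + 1) :=
    continuousAt_spinG_of_pos (by rw [hαb]; linarith) n
  have hGy : ContinuousAt (fun Δ : ℝ => spinG Δ ℓ n y) ((ℓ : ℝ) + 1) :=
    continuousAt_spinG_of_pos (by rw [hαb]; linarith) n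
  have hE : ContinuousAt (fun Δ : ℝ => spinE Δ ℓ n) ((ℓ : ℝ) + 1) :=
    continuousAt_spinE_of_pos (by linarith) (by rw [hαb]; norm_num) n
  have hE0 : spinE ((ℓ : ℝ) + 1) ℓ n = 0 := by
    obtain ⟨m, rfl⟩ : ∃ m, n = m + 1 := ⟨n - 1, by omega⟩
    exact spinE_bound_succ ℓ m
  have h : Tendsto (fun Δ : ℝ => spinG Δ ℓ n x * spinG Δ ℓ n y * spinE Δ ℓ n / legendreLam ℓ)
      (𝓝[>] ((ℓ : ℝ) + 1))
      (𝓝 (spinG ((ℓ : ℝ) + 1) ℓ n x * spinG ((ℓ : ℝ) + 1) ℓ n y * spinE ((ℓ : ℝ) + 1) ℓ n / legendreLam ℓ)) :=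
    (((hGx.mul hGy).mul hE).div_const (legendreLam ℓ)).mono_left nhdsWithin_le_nhds
  rw [hE0, mul_zero, zero_div] at h
  exact h

/-- **The limit of Hogervorst's site function at the bound**, site by site: `c_{ab}(Δ) → boundSite ℓ a b`
as `Δ ↓ ℓ + 1` (`ℓ ≥ 1`). [cite: Hogervorst2016, App. A] -/
theorem tendsto_spinSite_bound {ℓ : ℕ} (hℓ : 1 ≤ ℓ) (a b : ℕ) :
    Tendsto (fun Δ : ℝ => spinSite Δ ℓ a b) (𝓝[>] ((ℓ : ℝ) + 1)) (𝓝 (boundSite ℓ a b)) := by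
  by_cases hband : ℓ ≤ a + b ∧ (a + b + ℓ) % 2 = 0 ∧ a ≤ b + ℓ ∧ b ≤ a + ℓ
  · -- on the band: `(a,b) = (n+x, n+y)` with `x + y = ℓ`
    obtain ⟨h1, h2, h3, h4⟩ := hband
    obtain ⟨n, hn⟩ : ∃ n, a + b = ℓ + 2 * n := ⟨(a + b - ℓ) / 2, by omega⟩
    obtain ⟨x, hx⟩ : ∃ x, a = n + x := ⟨a - n, by omega⟩
    obtain ⟨y, hy⟩ : ∃ y, b = n + y := ⟨b - n, by omega⟩
    have hxy : x + y = ℓ := by omega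
    subst hx; subst hy
    rcases Nat.eq_zero_or_pos n with hn0 | hnpos
    · -- level 0: constant `λ_x λ_y / λ_ℓ`
      subst hn0
      have hfun : (fun Δ : ℝ => spinSite Δ ℓ (0 + x) (0 + y)) =
          fun _ => legendreLam x * legendreLam y / legendreLam ℓ := by
        funext Δ
        rw [spinSite_val (Δ := Δ) (ℓ := ℓ) 0 x y hxy]
        unfold spinG spinE
        simp
      rw [hfun]
      have hval : boundSite ℓ (0 + x) (0 + y) = legendreLam x * legendreLam y / legendreLam ℓ := by
        unfold boundSite; rw [if_pos (by omega)]; simp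
      rw [hval]
      exact tendsto_const_nhds
    · rcases Nat.eq_zero_or_pos x with hx0 | hxpos
      · -- edge `x = 0`, `y = ℓ`
        subst hx0
        have hyl : y = ℓ := by omega
        subst hyl
        simp only [Nat.add_zero]
        have hval : boundSite y n (n + y) = boundEps y n := by
          unfold boundSite
          rw [if_neg (by omega), if_pos (by omega)]
        rw [hval]
        exact tendsto_spinSite_edge hℓ n
      · rcases Nat.eq_zero_or_pos y with hy0 | hypos
        · -- edge `y = 0`, `x = ℓ`: by symmetry
          subst hy0
          have hxl : x = ℓ := by omega
          subst hxl
          simp only [Nat.add_zero]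
          have hval : boundSite x (n + x) n = boundEps x n := by
            unfold boundSite
            rw [if_neg (by omega), if_neg (by omega), if_pos (by omega)]
          rw [hval]
          have hfun : (fun Δ : ℝ => spinSite Δ x (n + x) n) = fun Δ => spinSite Δ x n (n + x) :=
            funext fun Δ => spinSite_symm (Δ := Δ) (ℓ := x) (n + x) n
          rw [hfun]
          exact tendsto_spinSite_edge hℓ n
        · -- interior
          have hval : boundSite ℓ (n + x) (n + y) = 0 := by
            unfold boundSite
            rw [if_neg (by omega), if_neg (by omega), if_neg (by omega)]
          rw [hval]
          exact tendsto_spinSite_interior hnpos hxpos hypos hxy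
  · -- off the band: identically zero on both sides
    have hfun : (fun Δ : ℝ => spinSite Δ ℓ a b) = fun _ => 0 := by
      funext Δ; unfold spinSite; rw [if_neg hband]
    have hval : boundSite ℓ a b = 0 := by
      unfold boundSite
      rw [if_neg (by omega), if_neg (by omega), if_neg (by omega)]
    rw [hfun, hval]
    exact tendsto_const_nhds

/-! ### §3. The reduction formula at the bound -/

/-- **Hogervorst's reduction formula at the unitarity bound `Δ = ℓ + 1`, `ℓ ≥ 1` (coefficient level):**
`hrMonomialCoeff (ℓ+1) ℓ = redArr (ℓ+1) ℓ (boundSite ℓ)` — the `z`-monomial array of the conserved-current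
block is the lattice sum of products of SL(2) blocks with the zero-twist site function. Proof: both sides of
`hrMonomialCoeff_eq_spin_redArr_of_lt` converge as `Δ ↓ ℓ+1` (left: continuity of the Hogervorst–Rychkov
recursion at the admissible bound point; right: §2 and continuity of the SL(2) coefficients at `α = ½`).
[cite: Hogervorst2016, App. A] [cite: Hogervorst2016, §2 eqs. (2.24), (2.35)] -/
theorem hrMonomialCoeff_eq_bound_redArr {ℓ : ℕ} (hℓ : 1 ≤ ℓ) :
    hrMonomialCoeff ((ℓ : ℝ) + 1) ℓ = redArr ((ℓ : ℝ) + 1) ℓ (boundSite ℓ) := by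
  funext p
  have hadm := isAdmissible3D_bound hℓ
  have hα0 : 0 < halfTwist ((ℓ : ℝ) + 1) ℓ := by rw [halfTwist_bound]; norm_num
  have hf : Tendsto (fun Δ => hrMonomialCoeff Δ ℓ p) (𝓝[>] ((ℓ : ℝ) + 1))
      (𝓝 (hrMonomialCoeff ((ℓ : ℝ) + 1) ℓ p)) :=
    (hadm.continuousAt_hrMonomialCoeff p).mono_left nhdsWithin_le_nhds
  have hg : Tendsto (fun Δ => ∑ a ∈ range (p.1 + 1), ∑ b ∈ range (p.2 + 1),
      spinSite Δ ℓ a b * siteK Δ ℓ a p.1 * siteK Δ ℓ b p.2) (𝓝[>] ((ℓ : ℝ) + 1))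
      (𝓝 (∑ a ∈ range (p.1 + 1), ∑ b ∈ range (p.2 + 1),
        boundSite ℓ a b * siteK ((ℓ : ℝ) + 1) ℓ a p.1 * siteK ((ℓ : ℝ) + 1) ℓ b p.2)) := by
    refine tendsto_finsetSum _ fun a _ => tendsto_finsetSum _ fun b _ => ?_
    exact ((tendsto_spinSite_bound hℓ a b).mul
      ((continuousAt_siteK hα0 a _).mono_left nhdsWithin_le_nhds)).mul
      ((continuousAt_siteK hα0 b _).mono_left nhdsWithin_le_nhds)
  have hev : ∀ᶠ Δ in 𝓝[>] ((ℓ : ℝ) + 1), hrMonomialCoeff Δ ℓ p = ∑ a ∈ range (p.1 + 1),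
      ∑ b ∈ range (p.2 + 1), spinSite Δ ℓ a b * siteK Δ ℓ a p.1 * siteK Δ ℓ b p.2 := by
    filter_upwards [self_mem_nhdsWithin] with Δ hΔ
    exact hrMonomialCoeff_spin_apply_of_lt hℓ (mem_Ioi.mp hΔ) p.1 p.2
  have h := tendsto_nhds_unique_of_eventuallyEq hf hg hev
  rw [h]
  rfl

/-- Entrywise form at the bound. [cite: Hogervorst2016, App. A] -/
theorem hrMonomialCoeff_bound_apply {ℓ : ℕ} (hℓ : 1 ≤ ℓ) (P Q : ℕ) :
    hrMonomialCoeff ((ℓ : ℝ) + 1) ℓ (P, Q) = ∑ a ∈ range (P + 1), ∑ b ∈ range (Q + 1),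
      boundSite ℓ a b * siteK ((ℓ : ℝ) + 1) ℓ a P * siteK ((ℓ : ℝ) + 1) ℓ b Q := by
  rw [hrMonomialCoeff_eq_bound_redArr hℓ]
  rfl

/-! ### §4. Function level: the conserved-current block as products of SL(2) blocks -/

/-- **Dimensional reduction, function level, from the monomial series** (generic in `Δ`): if `c ≥ 0`,
`hrMonomialCoeff Δ ℓ = redArr Δ ℓ c`, `α > ¼`, the coefficients `k^{HR}_{mn}(Δ,ℓ)` are non-negative and the
monomial series sums to `hrSeries Δ ℓ` at `(x,y)`, then `g^{HR}_{Δ,ℓ}(x,y) = Σ_{a,b} c_{ab} k_{2(α+a)}(x) k_{2(α+b)}(y)`.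
(The proof of `DimensionalReductionSeries.hasSum_redArr_sl2Block` with its two uses of `Δ > bound` turned into
hypotheses, so that it applies at the bound.) [cite: PalQiaoRychkov2023, App. A.2 Thm A.5] -/
theorem hasSum_redArr_sl2Block_of_hasSum {Δ : ℝ} {ℓ : ℕ} (hα : 1 / 4 < halfTwist Δ ℓ)
    (c : ℕ → ℕ → ℝ) (hc : ∀ a b, 0 ≤ c a b) (hred : hrMonomialCoeff Δ ℓ = redArr Δ ℓ c)
    (hnn : ∀ p, 0 ≤ hrMonomialCoeff Δ ℓ p) {x y : ℝ} (hx0 : 0 < x) (hx1 : x < 1) (hy0 : 0 < y) (hy1 : y < 1)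
    (hser : HasSum (fun p : ℕ × ℕ => hrMonomialCoeff Δ ℓ p * (x ^ p.1 * y ^ p.2)) (hrSeries Δ ℓ x y)) :
    HasSum (fun p : ℕ × ℕ => c p.1 p.2 * sl2Block (halfTwist Δ ℓ + p.1) x * sl2Block (halfTwist Δ ℓ + p.2) y)
      (hrBlock Δ ℓ x y) := by
  have hα0 : 0 < halfTwist Δ ℓ := by linarith
  have _ := hnn
  -- the four-index family, grouped by `(P,Q)`
  set G : (ℕ × ℕ) × (ℕ × ℕ) → ℝ :=
    fun r => c r.2.1 r.2.2 * siteK Δ ℓ r.2.1 r.1.1 * siteK Δ ℓ r.2.2 r.1.2 * (x ^ r.1.1 * y ^ r.1.2) with hG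
  have hGnn : 0 ≤ G := fun r => by
    have h1 := siteK_nonneg hα0 r.2.1 (r.1.1 : ℤ)
    have h2 := siteK_nonneg hα0 r.2.2 (r.1.2 : ℤ)
    have h3 := hc r.2.1 r.2.2
    simp only [hG]
    positivity
  have hfib : ∀ p : ℕ × ℕ, HasSum (fun q : ℕ × ℕ => G (p, q))
      (hrMonomialCoeff Δ ℓ p * (x ^ p.1 * y ^ p.2)) := fun p => by
    rw [hred]
    exact hasSum_redArr_fibre c p.1 p.2 x y
  have hGsum : Summable G := by
    rw [summable_prod_of_nonneg hGnn]
    exact ⟨fun p => (hfib p).summable, hser.summable.congr (fun p => ((hfib p).tsum_eq).symm)⟩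
  have hGhas : HasSum G (hrSeries Δ ℓ x y) := by
    have h1 : HasSum (fun p : ℕ × ℕ => hrMonomialCoeff Δ ℓ p * (x ^ p.1 * y ^ p.2)) (∑' r, G r) :=
      hGsum.hasSum.prod_fiberwise hfib
    rw [← h1.unique hser]
    exact hGsum.hasSum
  -- transport along `(a,b;i,j) ↦ (a+i,b+j;a,b)`
  set Φ : (ℕ × ℕ) × (ℕ × ℕ) → (ℕ × ℕ) × (ℕ × ℕ) :=
    fun r => ((r.1.1 + r.2.1, r.1.2 + r.2.2), r.1) with hΦ
  have hΦinj : Function.Injective Φ := by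
    rintro ⟨⟨a, b⟩, ⟨i, j⟩⟩ ⟨⟨a', b'⟩, ⟨i', j'⟩⟩ h
    simp only [hΦ, Prod.mk.injEq] at h
    obtain ⟨⟨h1, h2⟩, h3, h4⟩ := h
    subst h3; subst h4
    have hi : i = i' := by omega
    have hj : j = j' := by omega
    rw [hi, hj]
  have hΦsupp : ∀ r, r ∉ Set.range Φ → G r = 0 := by
    rintro ⟨⟨P, Q⟩, ⟨a, b⟩⟩ hr
    by_cases ha : a ≤ P
    · by_cases hb : b ≤ Q
      · exact (hr ⟨((a, b), (P - a, Q - b)), by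
          simp only [hΦ]
          rw [Nat.add_sub_cancel' ha, Nat.add_sub_cancel' hb]⟩).elim
      · have hb' : Q < b := Nat.lt_of_not_le hb
        simp only [hG]
        rw [siteK_eq_zero_of_lt (Δ := Δ) (ℓ := ℓ) b (by exact_mod_cast hb')]
        ring
    · have ha' : P < a := Nat.lt_of_not_le ha
      simp only [hG]
      rw [siteK_eq_zero_of_lt (Δ := Δ) (ℓ := ℓ) a (by exact_mod_cast ha')]
      ring
  have hF : HasSum (G ∘ Φ) (hrSeries Δ ℓ x y) := (hΦinj.hasSum_iff hΦsupp).mpr hGhas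
  -- the fibres `(a,b)` of `G ∘ Φ` are products of two SL(2) series
  have hfib2 : ∀ p : ℕ × ℕ, HasSum (fun q : ℕ × ℕ => (G ∘ Φ) (p, q))
      (c p.1 p.2 * ((x ^ p.1 * ∑' i : ℕ, sl2Coeff (halfTwist Δ ℓ + p.1) i * x ^ i) *
        (y ^ p.2 * ∑' j : ℕ, sl2Coeff (halfTwist Δ ℓ + p.2) j * y ^ j))) := fun p => by
    have hf := hasSum_sl2Coeff_shift hα p.1 hx0.le hx1
    have hg := hasSum_sl2Coeff_shift hα p.2 hy0.le hy1
    have ha : 0 < halfTwist Δ ℓ + p.1 := by positivity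
    have hb : 0 < halfTwist Δ ℓ + p.2 := by positivity
    have hfg := hf.summable.mul_of_nonneg hg.summable
      (fun i => mul_nonneg (sl2Coeff_nonneg ha i) (pow_nonneg hx0.le _))
      (fun j => mul_nonneg (sl2Coeff_nonneg hb j) (pow_nonneg hy0.le _))
    have h := (hf.mul hg hfg).mul_left (c p.1 p.2)
    refine h.congr_fun (fun q => ?_)
    simp only [Function.comp_apply, hΦ, hG, siteK_add]
    ring
  have hpairs := hF.prod_fiberwise hfib2
  -- multiply by `(xy)^α` and fold the SL(2) blocks
  have hblock := hpairs.mul_left ((x * y) ^ halfTwist Δ ℓ)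
  show HasSum _ ((x * y) ^ halfTwist Δ ℓ * hrSeries Δ ℓ x y)
  refine hblock.congr_fun (fun p => ?_)
  unfold sl2Block
  rw [Real.mul_rpow hx0.le hy0.le, Real.rpow_add hx0, Real.rpow_add hy0, Real.rpow_natCast,
    Real.rpow_natCast]
  ring

/-- **The conserved-current block as products of SL(2) blocks** (`ℓ ≥ 1`, `Δ = ℓ + 1`): on the open square,
`g_{ℓ+1,ℓ}(x,y) = Σ_{a,b} boundSite ℓ a b · k_{1+2a}(x) · k_{1+2b}(y)` — an explicit NON-NEGATIVE combination
(level `0`: `λ_aλ_b/λ_ℓ`; edges `|a-b| = ℓ`: `ε_{min(a,b)}(ℓ)`). The stress tensor is `ℓ = 2`.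
[cite: Hogervorst2016, App. A] [cite: PalQiaoRychkov2023, App. A.2 Thm A.5] -/
theorem hrBlock_hasSum_bound {ℓ : ℕ} (hℓ : 1 ≤ ℓ) {x y : ℝ} (hx0 : 0 < x) (hx1 : x < 1) (hy0 : 0 < y)
    (hy1 : y < 1) :
    HasSum (fun p : ℕ × ℕ => boundSite ℓ p.1 p.2 * sl2Block (halfTwist ((ℓ : ℝ) + 1) ℓ + p.1) x *
      sl2Block (halfTwist ((ℓ : ℝ) + 1) ℓ + p.2) y) (hrBlock ((ℓ : ℝ) + 1) ℓ x y) := by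
  have hα : 1 / 4 < halfTwist ((ℓ : ℝ) + 1) ℓ := by rw [halfTwist_bound]; norm_num
  refine hasSum_redArr_sl2Block_of_hasSum hα (boundSite ℓ) (boundSite_nonneg ℓ)
    (hrMonomialCoeff_eq_bound_redArr hℓ) (hrMonomialCoeff_bound_nonneg ℓ) hx0 hx1 hy0 hy1 ?_
  exact (hasSum_hrSeries_bound ℓ ⟨hx0, hx1⟩ ⟨hy0, hy1⟩).congr_fun fun p => by ring

/-- **The stress-tensor block** (`Δ = 3`, `ℓ = 2`) as products of SL(2) blocks. [cite: Hogervorst2016, App. A] -/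
theorem hrBlock_hasSum_stressTensor {x y : ℝ} (hx0 : 0 < x) (hx1 : x < 1) (hy0 : 0 < y) (hy1 : y < 1) :
    HasSum (fun p : ℕ × ℕ => boundSite 2 p.1 p.2 * sl2Block (halfTwist (3 : ℝ) 2 + p.1) x *
      sl2Block (halfTwist (3 : ℝ) 2 + p.2) y) (hrBlock 3 2 x y) := by
  have h := hrBlock_hasSum_bound (ℓ := 2) (by norm_num) hx0 hx1 hy0 hy1
  norm_num at h
  exact h

/-! ### §5. Radial positivity and unconditional radial convergence at the bound -/

/-- The `z`-side data at the bound: `A(ℓ+1,ℓ) ≥ 0` (`hrCoeff_bound_nonneg`) and the `z`-series of the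
conserved-current block (`hasSum_hrZTerm_hrBlock_bound`). [cite: DolanOsborn2011, §6 eq. (6.20)] -/
theorem hasZData_bound (ℓ : ℕ) : HasZData ((ℓ : ℝ) + 1) ℓ :=
  ⟨fun q => div_nonneg (hrCoeff_bound_nonneg ℓ q.1 q.2) (legendreLam_pos ℓ).le, by linarith,
    fun _ _ hx hy => (hasSum_hrZTerm_hrBlock_bound ℓ hx hy).congr_fun fun _ => rfl⟩

/-- The reduction hypothesis at the bound, discharged by `hrBlock_hasSum_bound`. [cite: Hogervorst2016, App. A] -/
theorem hasSL2Reduction_bound {ℓ : ℕ} (hℓ : 1 ≤ ℓ) : HasSL2Reduction ((ℓ : ℝ) + 1) ℓ (boundSite ℓ) :=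
  fun _ _ hx0 hx1 hy0 hy1 => hrBlock_hasSum_bound hℓ hx0 hx1 hy0 hy1

/-- **Radial monomial array `≥ 0` at the unitarity bound** (`ℓ ≥ 1`, `Δ = ℓ + 1`; e.g. the stress tensor).
[cite: HogervorstRychkov2013, §3.1] [cite: Hogervorst2016, App. A] -/
theorem zRhoConv_nonneg_bound {ℓ : ℕ} (hℓ : 1 ≤ ℓ) (p : ℕ × ℕ) :
    0 ≤ zRhoConv 0 ((ℓ : ℝ) + 1) ℓ (hrRadA ((ℓ : ℝ) + 1) ℓ) p :=
  zRhoConv_nonneg_of_hasSum (by rw [halfTwist_bound]; norm_num) (boundSite ℓ) (boundSite_nonneg ℓ)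
    (hasSL2Reduction_bound hℓ) (hasZData_bound ℓ) p

/-- **Unconditional radial convergence on the whole square at the unitarity bound** (`ℓ ≥ 1`, `Δ = ℓ + 1`).
[cite: HogervorstRychkov2013, §3.1] [cite: Hogervorst2016, App. A] -/
theorem hasSum_zRhoConv_hrBlock_bound {ℓ : ℕ} (hℓ : 1 ≤ ℓ) {s u : ℝ} (hs0 : 0 < s) (hs1 : s < 1)
    (hu0 : 0 < u) (hu1 : u < 1) :
    HasSum (fun p : ℕ × ℕ => zRhoConv 0 ((ℓ : ℝ) + 1) ℓ (hrRadA ((ℓ : ℝ) + 1) ℓ) p * (s ^ p.1 * u ^ p.2))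
      ((s * u) ^ (-(((ℓ : ℝ) + 1) - (ℓ : ℝ))) * (4 : ℝ) ^ (-((ℓ : ℝ) + 1)) *
        hrBlock ((ℓ : ℝ) + 1) ℓ (zOfRho (s ^ 2)) (zOfRho (u ^ 2))) :=
  hasSum_zRhoConv_hrBlock_of_hasSum (by rw [halfTwist_bound]; norm_num) (boundSite ℓ) (boundSite_nonneg ℓ)
    (hasSL2Reduction_bound hℓ) (hasZData_bound ℓ) hs0 hs1 hu0 hu1

/-! ### §6. Every admissible spinning point `Δ ≥ ℓ + 1` -/

/-- **Radial monomial array `≥ 0` for `ℓ ≥ 1` at EVERY `Δ ≥ ℓ + 1`** (bound: §5; above: `DimensionalReductionClosure`).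
[cite: HogervorstRychkov2013, §3.1] -/
theorem zRhoConv_nonneg_of_bound_le {Δ : ℝ} {ℓ : ℕ} (hℓ : 1 ≤ ℓ) (hΔ : (ℓ : ℝ) + 1 ≤ Δ) (p : ℕ × ℕ) :
    0 ≤ zRhoConv 0 Δ ℓ (hrRadA Δ ℓ) p := by
  rcases hΔ.eq_or_lt with h | h
  · rw [← h]; exact zRhoConv_nonneg_bound hℓ p
  · exact zRhoConv_nonneg_spin_of_lt hℓ h p

/-- **Unconditional radial convergence for `ℓ ≥ 1` at EVERY `Δ ≥ ℓ + 1`.** [cite: HogervorstRychkov2013, §3.1] -/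
theorem hasSum_zRhoConv_hrBlock_of_bound_le {Δ : ℝ} {ℓ : ℕ} (hℓ : 1 ≤ ℓ) (hΔ : (ℓ : ℝ) + 1 ≤ Δ)
    {s u : ℝ} (hs0 : 0 < s) (hs1 : s < 1) (hu0 : 0 < u) (hu1 : u < 1) :
    HasSum (fun p : ℕ × ℕ => zRhoConv 0 Δ ℓ (hrRadA Δ ℓ) p * (s ^ p.1 * u ^ p.2))
      ((s * u) ^ (-(Δ - (ℓ : ℝ))) * (4 : ℝ) ^ (-Δ) * hrBlock Δ ℓ (zOfRho (s ^ 2)) (zOfRho (u ^ 2))) := by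
  rcases hΔ.eq_or_lt with h | h
  · subst h; exact hasSum_zRhoConv_hrBlock_bound hℓ hs0 hs1 hu0 hu1
  · exact hasSum_zRhoConv_hrBlock_spin_of_lt hℓ h hs0 hs1 hu0 hu1

/-- **Typed form at every admissible spinning point**: for `ℓ ≥ 1`, `Δ ≥ ℓ + 1` (bound and accidental points
included — the typed predicate's limit clause; uniqueness `IsConformalBlock3D.eq_hrBlock_of_isAdmissible`) every
genuine even-sector block `g` has the non-negative radial monomial expansion converging on the whole square.
[cite: HogervorstRychkov2013, §3 after eq. (3.5)] -/
theorem IsConformalBlock3D.hasSum_zRhoConv_even_of_bound_le {Δ : ℝ} {ℓ : ℕ} {g : ℝ → ℝ → ℝ} (hℓ : 1 ≤ ℓ)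
    (hΔ : (ℓ : ℝ) + 1 ≤ Δ) (hg : IsConformalBlock3D 0 0 Δ ℓ g)
    {s u : ℝ} (hs0 : 0 < s) (hs1 : s < 1) (hu0 : 0 < u) (hu1 : u < 1) :
    HasSum (fun p : ℕ × ℕ => zRhoConv 0 Δ ℓ (hrRadA Δ ℓ) p * (s ^ p.1 * u ^ p.2))
      ((s * u) ^ (-(Δ - (ℓ : ℝ))) * (4 : ℝ) ^ (-Δ) * g (zOfRho (s ^ 2)) (zOfRho (u ^ 2))) := by
  have hs2 : s ^ 2 < 1 := by nlinarith
  have hu2 : u ^ 2 < 1 := by nlinarith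
  have hx : zOfRho (s ^ 2) ∈ Ioo (0 : ℝ) 1 :=
    ⟨zOfRho_pos (pow_pos hs0 2), zOfRho_lt_one (by nlinarith) hs2.ne⟩
  have hy : zOfRho (u ^ 2) ∈ Ioo (0 : ℝ) 1 :=
    ⟨zOfRho_pos (pow_pos hu0 2), zOfRho_lt_one (by nlinarith) hu2.ne⟩
  have hb : unitarityBound3D ℓ ≤ Δ := by
    unfold unitarityBound3D; rw [if_neg (by omega)]; exact hΔ
  have hadm : IsAdmissible3D Δ ℓ := ⟨hb, fun h => absurd h (by omega)⟩
  rw [hg.eq_hrBlock_of_isAdmissible hadm _ _ hx hy]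
  exact hasSum_zRhoConv_hrBlock_of_bound_le hℓ hΔ hs0 hs1 hu0 hu1

/-! ### §7. One statement for every admissible even-sector point `(Δ, ℓ)` -/

/-- **Radial monomial array `≥ 0` at EVERY admissible even-sector point**: `IsAdmissible3D Δ ℓ`
(`ℓ = 0`, `Δ > ½`: `EvenSectorRadialPositivity.zRhoConv_nonneg_scalar`; `ℓ ≥ 1`, `Δ ≥ ℓ + 1`: §6).
[cite: HogervorstRychkov2013, §3.1] -/
theorem zRhoConv_nonneg_of_isAdmissible {Δ : ℝ} {ℓ : ℕ} (hadm : IsAdmissible3D Δ ℓ) (p : ℕ × ℕ) :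
    0 ≤ zRhoConv 0 Δ ℓ (hrRadA Δ ℓ) p := by
  rcases Nat.eq_zero_or_pos ℓ with h | h
  · subst h
    have hΔ : (1 : ℝ) / 2 < Δ := by simpa [unitarityBound3D] using hadm.2 rfl
    exact zRhoConv_nonneg_scalar hΔ p
  · have hΔ : (ℓ : ℝ) + 1 ≤ Δ := by
      have h1 := hadm.1
      unfold unitarityBound3D at h1
      rwa [if_neg (by omega)] at h1
    exact zRhoConv_nonneg_of_bound_le h hΔ p

/-- **The radial monomial expansion of EVERY admissible even-sector block converges on the whole square**:
for `IsAdmissible3D Δ ℓ` and any `g` with `IsConformalBlock3D 0 0 Δ ℓ g`,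
`Σ_p zRhoConv(p) s^{p₁} u^{p₂} = (su)^{-(Δ-ℓ)} 4^{-Δ} g(z(s²), z(u²))` for all `0 < s, u < 1`, with
`zRhoConv(p) ≥ 0` (`zRhoConv_nonneg_of_isAdmissible`) — Hogervorst–Rychkov's "conformal block
representations as power series in ρ will converge for |ρ| < 1" for these blocks, with no unitarity input.
[cite: HogervorstRychkov2013, §3 after eq. (3.5)] -/
theorem IsConformalBlock3D.hasSum_zRhoConv_of_isAdmissible {Δ : ℝ} {ℓ : ℕ} {g : ℝ → ℝ → ℝ}
    (hadm : IsAdmissible3D Δ ℓ) (hg : IsConformalBlock3D 0 0 Δ ℓ g)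
    {s u : ℝ} (hs0 : 0 < s) (hs1 : s < 1) (hu0 : 0 < u) (hu1 : u < 1) :
    HasSum (fun p : ℕ × ℕ => zRhoConv 0 Δ ℓ (hrRadA Δ ℓ) p * (s ^ p.1 * u ^ p.2))
      ((s * u) ^ (-(Δ - (ℓ : ℝ))) * (4 : ℝ) ^ (-Δ) * g (zOfRho (s ^ 2)) (zOfRho (u ^ 2))) := by
  rcases Nat.eq_zero_or_pos ℓ with h | h
  · subst h
    have hΔ : (1 : ℝ) / 2 < Δ := by simpa [unitarityBound3D] using hadm.2 rfl
    exact hg.hasSum_zRhoConv_scalar hΔ hs0 hs1 hu0 hu1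
  · have hΔ : (ℓ : ℝ) + 1 ≤ Δ := by
      have h1 := hadm.1
      unfold unitarityBound3D at h1
      rwa [if_neg (by omega)] at h1
    exact hg.hasSum_zRhoConv_even_of_bound_le h hΔ hs0 hs1 hu0 hu1

end Literature.MathematicalPhysics.QuantumFieldTheory.ConformalBootstrap3D
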